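/-
Copyright (c) 2026 the pub-hodgecm-mathlib formalisation cell (harness21).  Prover seat hodgecm-mathlib-LH4-p09 (g2), req620 Track A «(D-RAM) FOUR-FRAME» squad
(unit U3_Laws, RULING (R-17) «NI2 ⊕ MS», registered stub `stub_U3_normIndexTwo`, NI2 SECOND SEAT = the «index ≤ 2 on units» half, dealer WORD #39 (2)):
`[U_F : N(E^×) ∩ U_F] ≤ 2` WITH A UNIT REPRESENTATIVE, at EVERY ramified quadratic datum, in the one-field datum currency.  2026-09-03.
-/
import Literature.NumberTheory.LocalFields.WildQuadraticDatumNormGradedSteps    -- ★ this seat (LEG 1): graded norm steps below ∕ at the break, fixed approximation, norm identity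
import Literature.NumberTheory.LocalFields.WildQuadraticDatumNormSurjective     -- ★ p854729 (LH4-p02): `exists_mul_map_eq_of_fixed_of_v_sub_one_le` (deep fixed one-units are norms); brings `IsRamifiedQuadraticDatum`
import Literature.NumberTheory.LocalFields.RamifiedQuadraticNormCriterion        -- ★ B-p10: tame index two `RamifiedQuadraticNorm.exists_fixed_isUnit_not_exists_mul_map_eq` ∕ `exists_mul_map_eq_or_eq_mul`
import HarnessLib

/-!
# The σ-FIXED UNITS of a ramified quadratic datum are norms up to index two: ONE fixed unit `c` with `U_F = (N ∩ U_F) ∪ c·(N ∩ U_F)`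
# (Serre, *Local Fields* V §3 Cor. 3 to Prop. 5: `U_F ∕ N U_E` has order `2` for a totally ramified quadratic extension; wild AND tame)

Topic `NumberTheory/LocalFields`; namespace `Literature.NumberTheory.LocalFields.WildQuadraticDatum` (the one-field datum: `σ` an involution of a discretely valued
field `K` with `v ∘ σ = v`, non-zero `σ`-fixed elements of even valuation, `ϖ` a uniformiser, `|ϖ − σϖ| = |ϖ|^d ≥ 1`, `|2| = |ϖ|^t` — ★ `IsRamifiedQuadraticDatum σ ϖ d t`; the fixed
field `F = K^σ` is never a type).  THEOREMS ONLY (no definition, no instance, no notation, no named fact, no `sorry`).  Cell `pub/hodgecm-mathlib` (D-0151), crux H413 =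
`stmt-HodgeConjecture-24833`; road «(D-RAM) FOUR-FRAME», unit U3_Laws, LEAD ruling (R-17) «NI2 ⊕ MS»: the registered stub `stub_U3_normIndexTwo` («local norm index two with
a unit representative», the `hNI` binder of ★ `F0P3cDyRamStableLawOfModelSum`) is NI2; this file is its UNIT HALF (dealer WORD #39 (2): second seat LH4-p09), imported by
the first seat's assembly `Theorems/F0P3cDyRamNormIndexTwo.lean` (F0P3-p01: reduction `x = (ϖσϖ)^{−n}·u`, the non-norm `c`, the head).

THE MATHEMATICS.  `N z := z·σz`, `U_F := {u : σu = u, |u| = 1}`.  CLAIM: there is `c ∈ U_F` with `∀ u ∈ U_F, u ∈ N(K) ∨ c·u ∈ N(K)`.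
* WILD (`|2| < 1`, §1; then `d ≥ 2` by ★ `eq_succ_of_odd`, write `d = n + 1`).  Serre V §3 Prop. 5 by INDUCTION ON THE LEVEL: starting from `w₀ = u` (`|u − 1| ≤ 1 = |π|⁰`,
  `π = ϖσϖ`), ★ `exists_norm_approx_below_break` (LEG 1 §2) produces at each level `m ≤ n − 1` a norm `N z′` with `|w_m − N z′| ≤ |π|^{m+1}`, and `w_{m+1} := w_m ∕ N z′` is again
  a fixed unit, `u = N(z₀⋯z_m)·w_{m+1}`; at the break `m = n` ★ `exists_norm_approx_at_break` (LEG 1 §3) gives — with ONE `c = 1 + κπⁿ` chosen before `u` — a norm with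
  `|w_n − N z′| ≤ |π|^{d}` OR `|c·w_n − N z′| ≤ |π|^{d}`; the quotient is a fixed unit `U` with `|U − 1| ≤ |ϖ|^{2d}`, hence a norm by ★ `exists_mul_map_eq_of_fixed_of_v_sub_one_le`
  (Serre V §3 Cor. 3, `N(U_E^{ψ(m)}) = U_F^{(m)}` for `m ≥ d`; this is where `[IsAdicComplete 𝓂[K] 𝒪[K]]` enters).  Multiplying up: `u = N(z)` or `c·u = N(z)`.
* TAME (`|2| = 1`, §2).  `σ` restricts to a residually trivial involution of the complete local ring `𝒪[K]` (★ `exists_fixed_v_sub_le`: `|σx − x| ≤ |ϖ|` on `𝒪[K]`), `2 ∈ 𝒪[K]ˣ`,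
  so ★ B-p10 `RamifiedQuadraticNorm.exists_fixed_isUnit_not_exists_mul_map_eq` gives a fixed unit `η` of non-square residue and ★ `exists_mul_map_eq_or_eq_mul` the dichotomy
  `u = sσs ∨ u = η·sσs`; take `c := η` (`η·u = N(ηs)`).
* §3 EVERY DATUM: `t = 0 ⇒ |2| = 1` (tame), `t ≥ 1 ⇒ |2| < 1` (wild).
What is NOT here (first seat's half, by the dealer's split): the passage from units to all of `F^×` (`σx = x ≠ 0 ⇒ |x| = exp(2n)`, `x = N(ϖ^{−n})·u`), the existence of a NON-norm
fixed unit at a wild place (the `c` below is not claimed to be a non-norm), and the summit-side head `stub_U3_normIndexTwo` under `[CompleteSpace K] [Fintype 𝓀[K]]`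
(★ `isAdicComplete_valuedInteger_of_completeSpace`).  HONEST LABEL: HC_CM is proved only modulo the 7 printed citations (2 remaining named inputs: hLiu418 =
stmt-HodgeConjecture-24832, h413 = stmt-HodgeConjecture-24833) until rung 0 closes; count-neutral, nothing printed is asserted — this is Serre V §3 PROVED for `ℓ = 2`.

## References
* [Serre1979] J.-P. Serre, *Local Fields*, GTM 67 (1979): Ch. V §3 Prop. 5, Cor. 2 and Cor. 3 pp. 85–87 (norm groups of a totally ramified cyclic extension of prime degree;
  `U_K ∕ N U_L` of order `ℓ`), Ch. XV §2 (norm groups and the local symbol).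
* [NeukirchANT1999] J. Neukirch, *Algebraic Number Theory* (1999): Ch. V (1.2)–(1.3) (the local norm index theorem).
-/

set_option autoImplicit false

open WithZero
open scoped Valued

namespace Literature.NumberTheory.LocalFields.WildQuadraticDatum

open Literature.NumberTheory.Automorphic.UnitaryThreeFourFrame

/-! ## §1 Wild places: induction on the level, then the deep levels -/

/-- **INDEX `≤ 2` ON THE FIXED UNITS AT A WILD PLACE** (`|2| < 1`; Serre V §3 Cor. 3 for `ℓ = p = 2`): for a ramified quadratic datum over a field whose valuation ring is
`𝓂`-adically complete with finite residue field, there is ONE `σ`-fixed unit `c` such that every `σ`-fixed unit `u` is a norm `zσz` or `c·u` is.  Induction on the level with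
★ `exists_norm_approx_below_break`, the break by ★ `exists_norm_approx_at_break`, the deep quotient by ★ `exists_mul_map_eq_of_fixed_of_v_sub_one_le`.
[cite: Serre1979, Ch. V §3 Prop. 5, Cor. 3] [cite: NeukirchANT1999, Ch. V (1.2)] -/
theorem exists_unit_norm_dichotomy_of_v_two_lt_one {K : Type} [Field K] [Valued K ℤᵐ⁰] [IsAdicComplete 𝓂[K] 𝒪[K]] [Finite 𝓀[K]]
    (σ : K →+* K) (ϖ : K) (d t : ℕ) (hD : IsRamifiedQuadraticDatum σ ϖ d t) (h2v : Valued.v (2 : K) < 1) :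
    ∃ c : K, σ c = c ∧ Valued.v c = 1 ∧
      ∀ u : K, σ u = u → Valued.v u = 1 → (∃ z : K, z * σ z = u) ∨ ∃ z : K, z * σ z = c * u := by
  obtain ⟨hσ, hvσ, hϖ, hfix, hd, -, ht⟩ := hD
  -- at a wild place `d ≥ 2` (`d = 1` is odd, hence `d = t + 1`, `t = 0`, `|2| = 1`)
  have hd2 : 2 ≤ d := by
    by_contra hlt
    have hd0 : d ≠ 0 := fun h => by
      rw [h, pow_zero] at hd
      have h1 : Valued.v (ϖ - σ ϖ) ≤ max (Valued.v ϖ) (Valued.v (σ ϖ)) := Valuation.map_sub _ _ _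
      rw [hvσ, max_self, hd, hϖ, ← exp_zero, exp_le_exp] at h1
      omega
    have hodd : Odd d := ⟨0, by omega⟩
    have hdt := eq_succ_of_odd hσ hfix hϖ hd ht hodd
    have ht0 : t = 0 := by omega
    rw [ht, ht0, pow_zero] at h2v
    exact lt_irrefl _ h2v
  obtain ⟨n, hn⟩ : ∃ n : ℕ, n + 1 = d := ⟨d - 1, by omega⟩
  -- ONE `c` from the break level, chosen before `u`
  obtain ⟨c, hσc, hc1, hbreak⟩ := exists_norm_approx_at_break hσ hvσ hfix hϖ hd ht h2v hn (by omega)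
  have hvc : Valued.v c = 1 := by
    have h := Valuation.map_eq_of_sub_lt Valued.v (show Valued.v (c - 1) < Valued.v (1 : K) by rw [Valued.v.map_one]; exact hc1)
    rwa [Valued.v.map_one] at h
  refine ⟨c, hσc, hvc, fun u hσu hu1 => ?_⟩
  -- climbing the levels `m ≤ n`: `u = N(z)·w` with `w` a fixed unit, `|w − 1| ≤ exp(−2m)`
  have hclimb : ∀ m : ℕ, m ≤ n → ∃ z w : K, z * σ z ≠ 0 ∧ u = z * σ z * w ∧ σ w = w ∧ Valued.v w = 1 ∧
      Valued.v (w - 1) ≤ exp (-(2 * (m : ℤ))) := by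
    intro m
    induction m with
    | zero =>
      intro _
      refine ⟨1, u, by simp, by simp, hσu, hu1, ?_⟩
      calc Valued.v (u - 1) ≤ max (Valued.v u) (Valued.v 1) := Valuation.map_sub _ _ _
        _ = exp (-(2 * ((0 : ℕ) : ℤ))) := by rw [hu1, Valued.v.map_one, max_self]; simp
    | succ m ih =>
      intro hm
      obtain ⟨z, w, hz0, huzw, hσw, hw1, hw⟩ := ih (by omega)
      obtain ⟨z', hz'1, hz'⟩ := exists_norm_approx_below_break hσ hvσ hfix hϖ hd ht h2v (n := m) (by omega) hσw hw1 hw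
      have hN1 : Valued.v (z' * σ z') = 1 := by rw [map_mul, hvσ, hz'1, mul_one]
      have hN0 : z' * σ z' ≠ 0 := (Valuation.ne_zero_iff _).1 (by rw [hN1]; exact one_ne_zero)
      refine ⟨z * z', w / (z' * σ z'), ?_, ?_, ?_, ?_, ?_⟩
      · rw [← mul_map_mul_map]; exact mul_ne_zero hz0 hN0
      · rw [← mul_map_mul_map, huzw, mul_assoc (z * σ z), mul_div_assoc', mul_div_cancel_left₀ _ hN0]
      · rw [map_div₀, hσw, map_mul_map hσ]
      · rw [map_div₀, hw1, hN1, div_one]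
      · rw [div_sub_one hN0, map_div₀, hN1, div_one]
        have hcast : (-(2 * ((m + 1 : ℕ) : ℤ)) : ℤ) = -(2 * (m : ℤ) + 2) := by push_cast; ring
        rw [hcast]
        exact hz'
  obtain ⟨z, w, hz0, huzw, hσw, hw1, hw⟩ := hclimb n le_rfl
  -- the break
  obtain ⟨z', hz'1, hcase⟩ := hbreak w hσw hw1 hw
  have hN1 : Valued.v (z' * σ z') = 1 := by rw [map_mul, hvσ, hz'1, mul_one]
  have hN0 : z' * σ z' ≠ 0 := (Valuation.ne_zero_iff _).1 (by rw [hN1]; exact one_ne_zero)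
  have hexp : exp (-(2 * (n : ℤ) + 2)) = Valued.v ϖ ^ (2 * d) := by
    rw [v_varpi_pow hϖ]; congr 1; push_cast; omega
  rcases hcase with h | h
  · -- `U := w ∕ N z′` is a deep fixed one-unit, hence a norm
    have hσU : σ (w / (z' * σ z')) = w / (z' * σ z') := by rw [map_div₀, hσw, map_mul_map hσ]
    have hU : Valued.v (w / (z' * σ z') - 1) ≤ Valued.v ϖ ^ (2 * d) := by
      rw [div_sub_one hN0, map_div₀, hN1, div_one, ← hexp]; exact h
    obtain ⟨z'', hz'', -⟩ := exists_mul_map_eq_of_fixed_of_v_sub_one_le hσ hvσ hfix hϖ hd ht hσU hU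
    refine Or.inl ⟨z * z' * z'', ?_⟩
    rw [← mul_map_mul_map, ← mul_map_mul_map, hz'', huzw, mul_assoc, mul_div_assoc', mul_div_cancel_left₀ _ hN0]
  · -- `U := c·w ∕ N z′`
    have hσU : σ (c * w / (z' * σ z')) = c * w / (z' * σ z') := by rw [map_div₀, map_mul, hσc, hσw, map_mul_map hσ]
    have hU : Valued.v (c * w / (z' * σ z') - 1) ≤ Valued.v ϖ ^ (2 * d) := by
      rw [div_sub_one hN0, map_div₀, hN1, div_one, ← hexp]; exact h
    obtain ⟨z'', hz'', -⟩ := exists_mul_map_eq_of_fixed_of_v_sub_one_le hσ hvσ hfix hϖ hd ht hσU hU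
    refine Or.inr ⟨z * z' * z'', ?_⟩
    rw [← mul_map_mul_map, ← mul_map_mul_map, hz'', huzw, mul_assoc, mul_div_assoc', mul_div_cancel_left₀ _ hN0]
    ring

/-! ## §2 Tame places: the residually trivial involution of the complete local ring `𝒪[K]` (★ B-p10) -/

/-- **INDEX `≤ 2` ON THE FIXED UNITS AT A TAME PLACE** (`|2| = 1`; Serre V §3 Cor. 2: `N U_E = {u ∈ U_F : ū ∈ 𝓀ˣ²}`, index two): `σ` restricts to a residually trivial involution
of `𝒪[K]` (★ `exists_fixed_v_sub_le`), `2 ∈ 𝒪[K]ˣ`, and ★ `RamifiedQuadraticNorm.exists_fixed_isUnit_not_exists_mul_map_eq` ∕ `exists_mul_map_eq_or_eq_mul` give a fixed unit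
`η` with `u = sσs ∨ u = η·sσs` for every fixed unit `u`; `c := η` (`η·u = N(ηs)` in the second case). [cite: Serre1979, Ch. V §3 Prop. 5, Cor. 2] -/
theorem exists_unit_norm_dichotomy_of_v_two_eq_one {K : Type} [Field K] [Valued K ℤᵐ⁰] [IsAdicComplete 𝓂[K] 𝒪[K]] [Finite 𝓀[K]]
    (σ : K →+* K) (ϖ : K) (d t : ℕ) (hD : IsRamifiedQuadraticDatum σ ϖ d t) (h2 : Valued.v (2 : K) = 1) :
    ∃ c : K, σ c = c ∧ Valued.v c = 1 ∧
      ∀ u : K, σ u = u → Valued.v u = 1 → (∃ z : K, z * σ z = u) ∨ ∃ z : K, z * σ z = c * u := by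
  obtain ⟨hσ, hvσ, hϖ, hfix, hd, -, -⟩ := hD
  have hϖ1 : exp (-1 : ℤ) < (1 : ℤᵐ⁰) := by rw [← exp_zero, exp_lt_exp]; norm_num
  -- `σ` restricted to the valuation ring
  have hσO : ∀ x : 𝒪[K], σ (x : K) ∈ 𝒪[K] := fun x =>
    (Valuation.mem_integer_iff _ _).2 (by rw [hvσ]; exact (Valuation.mem_integer_iff _ _).1 x.2)
  let σO : 𝒪[K] →+* 𝒪[K] := (σ.comp (𝒪[K]).subtype).codRestrict 𝒪[K] hσO
  have hσO' : ∀ x : 𝒪[K], ((σO x : 𝒪[K]) : K) = σ x := fun _ => rfl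
  have hσσ : ∀ x, σO (σO x) = x := fun x => Subtype.ext (by rw [hσO', hσO', hσ])
  -- residually trivial
  have hres : ∀ x : 𝒪[K], σO x - x ∈ IsLocalRing.maximalIdeal 𝒪[K] := by
    intro x
    obtain ⟨a, hσa, -, hxa⟩ := exists_fixed_v_sub_le hσ hfix hϖ hd (x := (x : K)) ((Valuation.mem_integer_iff _ _).1 x.2)
    apply (mem_maximalIdeal_iff_v_lt_one _).2
    have hcoe : ((σO x - x : 𝒪[K]) : K) = σ ((x : K) - a) - ((x : K) - a) := by
      rw [AddSubgroupClass.coe_sub, hσO', map_sub, hσa]; ring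
    rw [hcoe]
    calc Valued.v (σ ((x : K) - a) - ((x : K) - a)) ≤ max (Valued.v (σ ((x : K) - a))) (Valued.v ((x : K) - a)) :=
          Valuation.map_sub _ _ _
      _ = Valued.v ((x : K) - a) := by rw [hvσ, max_self]
      _ < 1 := lt_of_le_of_lt hxa hϖ1
  -- `2` is a unit of `𝒪[K]`
  have hint := Valuation.integer.integers (Valued.v : Valuation K ℤᵐ⁰)
  have h2O : IsUnit (2 : 𝒪[K]) := hint.isUnit_iff_valuation_eq_one.2 (by rw [map_ofNat]; exact h2)
  -- the non-square fixed unit `η`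
  obtain ⟨η, hηu, hση, hηsq, -⟩ := RamifiedQuadraticNorm.exists_fixed_isUnit_not_exists_mul_map_eq σO hσσ hres h2O
  have hvη : Valued.v (η : K) = 1 := hint.isUnit_iff_valuation_eq_one.1 hηu
  have hσηK : σ (η : K) = η := by rw [← hσO', hση]
  refine ⟨(η : K), hσηK, hvη, fun u hσu hu1 => ?_⟩
  set uO : 𝒪[K] := ⟨u, (Valuation.mem_integer_iff _ _).2 hu1.le⟩ with huO_def
  have huO : IsUnit uO := hint.isUnit_iff_valuation_eq_one.2 hu1
  have hσuO : σO uO = uO := Subtype.ext (by rw [hσO']; exact hσu)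
  obtain ⟨s, hs | hs⟩ := RamifiedQuadraticNorm.exists_mul_map_eq_or_eq_mul σO hσσ hres h2O hση hηsq huO hσuO
  · refine Or.inl ⟨(s : K), ?_⟩
    have h := congrArg (fun x : 𝒪[K] => (x : K)) hs
    simpa only [Subring.coe_mul, hσO'] using h
  · refine Or.inr ⟨(η : K) * s, ?_⟩
    have h := congrArg (fun x : 𝒪[K] => (x : K)) hs
    simp only [Subring.coe_mul, hσO'] at h
    have h' : (η : K) * ((s : K) * σ s) = u := h
    rw [map_mul, hσηK, ← h']
    ring

/-! ## §3 Every ramified quadratic datum -/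

/-- **`U_F ⊆ N(K^×) ∪ c⁻¹·N(K^×)` WITH ONE FIXED UNIT `c`, AT EVERY RAMIFIED QUADRATIC DATUM** over a field with `𝓂`-adically complete valuation ring and finite residue field
(`t = 0`: tame §2; `t ≥ 1`: wild §1) — the UNIT HALF of «local norm index two with a unit representative» (NI2); the first seat's assembly adds `x = (ϖσϖ)^{−n}·u`.
[cite: Serre1979, Ch. V §3 Cor. 2, Cor. 3] [cite: NeukirchANT1999, Ch. V (1.3)] -/
theorem exists_unit_norm_dichotomy_of_isRamifiedQuadraticDatum {K : Type} [Field K] [Valued K ℤᵐ⁰] [IsAdicComplete 𝓂[K] 𝒪[K]] [Finite 𝓀[K]]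
    (σ : K →+* K) (ϖ : K) (d t : ℕ) (hD : IsRamifiedQuadraticDatum σ ϖ d t) :
    ∃ c : K, σ c = c ∧ Valued.v c = 1 ∧
      ∀ u : K, σ u = u → Valued.v u = 1 → (∃ z : K, z * σ z = u) ∨ ∃ z : K, z * σ z = c * u := by
  have ht := hD.2.2.2.2.2.2
  rcases Nat.eq_zero_or_pos t with h0 | hpos
  · exact exists_unit_norm_dichotomy_of_v_two_eq_one σ ϖ d t hD (by rw [ht, h0, pow_zero])
  · refine exists_unit_norm_dichotomy_of_v_two_lt_one σ ϖ d t hD ?_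
    rw [ht, v_varpi_pow hD.2.2.1, ← exp_zero, exp_lt_exp]
    omega

end Literature.NumberTheory.LocalFields.WildQuadraticDatum
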